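import Mathlib
import Literature.NumberTheory.Transcendental.SemialgebraicMaps
import Literature.Analysis.Complex.LengthArea

/-!
# The 2-isogeny x-map `R(w) = w + a + b/w` as a two-sheeted change of variables of the plane
(support of item stmt-KontsevichZagierPeriods-2879 `TwoIsogenyAreaIdentity`, route MultivaluedCoV)

For `E : y² = P(x) = x³ + a x² + b x` and `E' : Y² = Q(X) = X³ − 2a X² + (a² − 4b) X` the 2-isogeny
`E → E'` with kernel `(0,0)` has x-coordinate `R(x) = x + a + b/x` (Silverman AEC III.4.5). This
file collects everything about `R` that the KZ-derivation of the area identity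
`∬ dA/|P| = 2 ∬ dA/|Q|` (`MultivaluedCoVTwoIsogenyAreaIdentity.lean`) needs:

* algebra on `ℂ`: `R w = R w' ↔ w = w' ∨ w w' = b` (`R` is the quotient by `w ↦ b/w`);
  `Q (R w) = (w² + a w + b)(w² − b)²/w³`, whence the Jacobian identity
  `1/‖P w‖ = (1/‖Q (R w)‖)·‖R' w‖²`, `R' w = 1 − b/w²` (`φ^*(dX/Y) = −dx/y`); every `W` has a
  non-zero preimage `z` (a root of `z² − (W − a) z + b`), the other being `b/z`; and the sign
  pattern `Im (R w) ≠ 0 ∧ Re (R w) ≠ a ↔ Re w ≠ 0 ∧ Im w ≠ 0 ∧ |w|⁴ ≠ b²`;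
* the real picture through `e : ℝ² ≃L[ℝ] ℂ`, `Φ = e⁻¹ ∘ R ∘ e`: Fréchet derivative with
  determinant `‖R'‖²` (`hasFDerivAt_Phi`), `ℚ`-semialgebraicity on `{x ≠ 0}`
  (`isSemialgebraicMapOn_Phi`), and the two SHEETS `σ₀ = {x, y ≠ 0, (x²+y²)² > b²}`,
  `σ₁ = {x, y ≠ 0, (x²+y²)² < b²}`, each mapped injectively (`injOn_Phi`) onto
  `T = {Re ≠ a, Im ≠ 0}` (`image_Phi`).

No `def`s: the maps are carried as explicit lambdas / hypotheses `e`, `he`, `he'`.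

References: J. H. Silverman, *The Arithmetic of Elliptic Curves* (2009), III.4.5, III.5;
M. Kontsevich, D. Zagier, *Periods* (2001), §1.2 rule (2); J. Bochnak, M. Coste, M.-F. Roy,
*Real Algebraic Geometry* (1998), §2.2.
-/

noncomputable section

open Complex

namespace Summit.KontsevichZagierPeriods.MultivaluedCoV.TwoIsogenyAreaIdentity

/-- `R w − R w' = (w − w')(w w' − b)/(w w')` for the x-map `R w = w + a + b/w`. [folklore] -/
theorem xmap_sub_xmap (a b : ℂ) {w w' : ℂ} (hw : w ≠ 0) (hw' : w' ≠ 0) :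
    (w + a + b / w) - (w' + a + b / w') = (w - w') * (w * w' - b) / (w * w') := by
  field_simp
  ring

/-- The x-map of the 2-isogeny is two-to-one: `R w = R w' ↔ w = w' ∨ w w' = b` (`w, w' ≠ 0`).
[cite: SilvermanAEC2009, III.4.5] -/
theorem xmap_eq_xmap_iff (a b : ℂ) {w w' : ℂ} (hw : w ≠ 0) (hw' : w' ≠ 0) :
    w + a + b / w = w' + a + b / w' ↔ w = w' ∨ w * w' = b := by
  rw [← sub_eq_zero, xmap_sub_xmap a b hw hw', div_eq_zero_iff, mul_eq_zero, mul_eq_zero,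
    sub_eq_zero, sub_eq_zero]
  constructor
  · rintro ((h | h) | h | h)
    · exact Or.inl h
    · exact Or.inr h
    · exact (hw h).elim
    · exact (hw' h).elim
  · rintro (h | h)
    · exact Or.inl (Or.inl h)
    · exact Or.inl (Or.inr h)

/-- `Q ∘ R` factors through `P`: `Q (R w) = (w² + a w + b)(w² − b)²/w³` where
`Q X = X³ − 2aX² + (a² − 4b)X` (`(R w − a)² − 4b = (w − b/w)²`). [cite: SilvermanAEC2009, III.4.5] -/
theorem Q_xmap (a b : ℂ) {w : ℂ} (hw : w ≠ 0) :
    (w + a + b / w) ^ 3 - 2 * a * (w + a + b / w) ^ 2 + (a ^ 2 - 4 * b) * (w + a + b / w) =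
      (w ^ 2 + a * w + b) * (w ^ 2 - b) ^ 2 / w ^ 3 := by
  field_simp
  ring

/-- `P w = w (w² + a w + b)`. [folklore] -/
theorem P_factor (a b w : ℂ) : w ^ 3 + a * w ^ 2 + b * w = w * (w ^ 2 + a * w + b) := by ring

/-- **Jacobian identity of the 2-isogeny** (`φ^* (dX/Y) = −dx/y` in absolute value squared):
`1/‖P w‖ = (1/‖Q (R w)‖) · ‖1 − b/w²‖²` for `w ≠ 0`, `w² ≠ b` (both sides vanish at the roots of
`w² + a w + b`, with Lean's `1/0 = 0`). [cite: SilvermanAEC2009, III.4.5, III.5] -/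
theorem jacobian_identity (a b : ℂ) {w : ℂ} (hw : w ≠ 0) (hwb : w ^ 2 ≠ b) :
    1 / ‖w ^ 3 + a * w ^ 2 + b * w‖ =
      1 / ‖(w + a + b / w) ^ 3 - 2 * a * (w + a + b / w) ^ 2 + (a ^ 2 - 4 * b) * (w + a + b / w)‖ *
        ‖1 - b / w ^ 2‖ ^ 2 := by
  rw [Q_xmap a b hw, P_factor]
  have h1 : 1 - b / w ^ 2 = (w ^ 2 - b) / w ^ 2 := by field_simp
  rw [h1]
  simp only [norm_div, norm_mul, norm_pow]
  have hn : ‖w‖ ≠ 0 := norm_ne_zero_iff.mpr hw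
  have hd : ‖w ^ 2 - b‖ ≠ 0 := norm_ne_zero_iff.mpr (sub_ne_zero.mpr hwb)
  by_cases hN : ‖w ^ 2 + a * w + b‖ = 0
  · simp [hN]
  · field_simp

/-- The complex derivative of the x-map: `R' w = 1 − b/w²` (`w ≠ 0`). [folklore] -/
theorem hasDerivAt_xmap (a b : ℂ) {w : ℂ} (hw : w ≠ 0) :
    HasDerivAt (fun z : ℂ => z + a + b / z) (1 - b / w ^ 2) w := by
  have h1 : HasDerivAt (fun z : ℂ => z + a) 1 w := (hasDerivAt_id w).add_const a
  have h2 : HasDerivAt (fun z : ℂ => b * z⁻¹) (b * (-(w ^ 2)⁻¹)) w := (hasDerivAt_inv hw).const_mul b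
  have h : HasDerivAt (fun z : ℂ => z + a + b * z⁻¹) (1 + b * (-(w ^ 2)⁻¹)) w := h1.add h2
  have hf : (fun z : ℂ => z + a + b / z) = fun z => z + a + b * z⁻¹ := by
    funext z
    rw [div_eq_mul_inv]
  rw [hf]
  refine h.congr_deriv ?_
  rw [div_eq_mul_inv]
  ring

/-- Every `W` has a non-zero preimage under the x-map: a root `z ≠ 0` of `z² − (W − a) z + b = 0`
(`b ≠ 0`; `ℂ` algebraically closed), and then `R z = W`. [folklore] -/
theorem exists_xmap_eq (a : ℂ) {b : ℂ} (hb : b ≠ 0) (W : ℂ) :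
    ∃ z : ℂ, z ≠ 0 ∧ z + a + b / z = W := by
  obtain ⟨z, hz⟩ : ∃ z : ℂ, 1 * (z * z) + (-(W - a)) * z + b = 0 :=
    exists_quadratic_eq_zero one_ne_zero (IsAlgClosed.exists_eq_mul_self _)
  have hz0 : z ≠ 0 := by
    rintro rfl
    apply hb
    simpa using hz
  refine ⟨z, hz0, ?_⟩
  have : z + a + b / z - W = (1 * (z * z) + (-(W - a)) * z + b) / z := by
    field_simp
    ring
  rw [← sub_eq_zero, this, hz, zero_div]

/-- The companion preimage: if `R z = W` then `R (b/z) = W` (`b ≠ 0`). [folklore] -/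
theorem xmap_div_eq (a : ℂ) {b : ℂ} (z : ℂ) (hb : b ≠ 0) :
    b / z + a + b / (b / z) = z + a + b / z := by
  field_simp
  ring

/-- Real and imaginary parts of the x-map for real `a, b`:
`Re (R w) = x + a + b x/|w|²`, `Im (R w) = y − b y/|w|²`. [folklore] -/
theorem xmap_re_im (a b : ℝ) (w : ℂ) :
    (w + a + b / w).re = w.re + a + b * w.re / Complex.normSq w ∧
      (w + a + b / w).im = w.im - b * w.im / Complex.normSq w := by
  constructor
  · simp [Complex.div_re]
  · simp [Complex.div_im]
    ring

/-- **Sign pattern of the x-map** (`w ≠ 0`, `a, b` real): `Im (R w) ≠ 0 ∧ Re (R w) ≠ a` iff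
`Re w ≠ 0 ∧ Im w ≠ 0 ∧ |w|⁴ ≠ b²` (`Im R = y(|w|² − b)/|w|²`, `Re R − a = x(|w|² + b)/|w|²`).
[folklore] -/
theorem xmap_good_iff (a b : ℝ) {w : ℂ} (hw : w ≠ 0) :
    ((w + a + b / w).im ≠ 0 ∧ (w + a + b / w).re ≠ a) ↔
      (w.re ≠ 0 ∧ w.im ≠ 0 ∧ Complex.normSq w ^ 2 ≠ b ^ 2) := by
  obtain ⟨hre, him⟩ := xmap_re_im a b w
  have hρ : 0 < Complex.normSq w := Complex.normSq_pos.mpr hw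
  have hρ0 : Complex.normSq w ≠ 0 := hρ.ne'
  have e1 : (w + a + b / w).im = w.im * (Complex.normSq w - b) / Complex.normSq w := by
    rw [him]
    field_simp
  have e2 : (w + a + b / w).re - a = w.re * (Complex.normSq w + b) / Complex.normSq w := by
    rw [hre]
    field_simp
    ring
  have e3 : Complex.normSq w ^ 2 - b ^ 2 = (Complex.normSq w - b) * (Complex.normSq w + b) := by
    ring
  rw [show ((w + a + b / w).re ≠ a) ↔ ((w + a + b / w).re - a ≠ 0) from sub_ne_zero.symm, e1, e2,
    show (Complex.normSq w ^ 2 ≠ b ^ 2) ↔ (Complex.normSq w ^ 2 - b ^ 2 ≠ 0) from sub_ne_zero.symm,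
    e3]
  simp only [ne_eq, div_eq_zero_iff, mul_eq_zero, hρ0, or_false, not_or]
  tauto

/-- `|b/z|² = b²/|z|²`. [folklore] -/
theorem normSq_div_self (b : ℝ) (z : ℂ) :
    Complex.normSq (b / z) = b ^ 2 / Complex.normSq z := by
  rw [map_div₀, Complex.normSq_ofReal, sq]

/-! ### The plane `ℝ²` as `ℂ`, the sheets and the image -/

open Set MeasureTheory MvPolynomial
open Literature.NumberTheory.Transcendental Literature.ModelTheory.ExponentialFields

/-- The identification `ℝ² ≃ ℂ`, `p ↦ p 0 + p 1 · I`, with inverse `w ↦ (Re w, Im w)`. [folklore] -/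
theorem exists_equiv : ∃ e : (Fin 2 → ℝ) ≃L[ℝ] ℂ,
    (∀ p, e p = p 0 + p 1 * I) ∧ (∀ w, e.symm w = ![w.re, w.im]) :=
  ⟨(ContinuousLinearEquiv.finTwoArrow ℝ ℝ).trans Complex.equivRealProdCLM.symm,
    fun p => by simp [Complex.equivRealProdCLM_symm_apply], fun w => by simp⟩

section Equiv

variable (e : (Fin 2 → ℝ) ≃L[ℝ] ℂ) (he : ∀ p, e p = p 0 + p 1 * I) (he' : ∀ w, e.symm w = ![w.re, w.im])
include he in
/-- Coordinates of `e p`. [folklore] -/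
theorem equiv_re_im (p : Fin 2 → ℝ) :
    (e p).re = p 0 ∧ (e p).im = p 1 ∧ Complex.normSq (e p) = p 0 ^ 2 + p 1 ^ 2 := by
  refine ⟨by simp [he], by simp [he], ?_⟩
  rw [Complex.normSq_apply]
  simp [he]
  ring

include he in
/-- `e p = 0` iff both coordinates vanish; in particular `p 0 ≠ 0 → e p ≠ 0`. [folklore] -/
theorem equiv_ne_zero {p : Fin 2 → ℝ} (hp : p 0 ≠ 0) : e p ≠ 0 := by
  intro h
  have := (equiv_re_im e he p).1
  rw [h, Complex.zero_re] at this
  exact hp this.symm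

include he' in
/-- Coordinates of `e.symm w`. [folklore] -/
theorem equiv_symm_apply (w : ℂ) : e.symm w 0 = w.re ∧ e.symm w 1 = w.im := by
  simp [he']

/-- **Derivative and Jacobian of the x-map as a real map of the plane.** At `p` with `e p ≠ 0`
the map `Φ = e⁻¹ ∘ R ∘ e` has Fréchet derivative `e⁻¹ ∘ (R'(e p) · ) ∘ e`, of determinant
`‖R'(e p)‖² = ‖1 − b/(e p)²‖²` (a holomorphic map has real Jacobian `|f'|²`). [folklore] -/
theorem hasFDerivAt_Phi (a b : ℂ) {p : Fin 2 → ℝ} (hp : e p ≠ 0) :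
    ∃ L : (Fin 2 → ℝ) →L[ℝ] (Fin 2 → ℝ),
      HasFDerivAt (fun q => e.symm (e q + a + b / e q)) L p ∧ L.det = ‖1 - b / e p ^ 2‖ ^ 2 := by
  set c : ℂ := 1 - b / e p ^ 2 with hc
  set Lc : ℂ →L[ℝ] ℂ := (ContinuousLinearMap.smulRight (1 : ℂ →L[ℂ] ℂ) c).restrictScalars ℝ
    with hLc
  refine ⟨(e.symm : ℂ →L[ℝ] (Fin 2 → ℝ)).comp (Lc.comp (e : (Fin 2 → ℝ) →L[ℝ] ℂ)), ?_, ?_⟩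
  · have h1 : HasFDerivAt (fun w : ℂ => w + a + b / w) Lc (e p) :=
      (hasDerivAt_xmap a b hp).hasFDerivAt.restrictScalars ℝ
    have h2 : HasFDerivAt (fun q : Fin 2 → ℝ => e q + a + b / e q)
        (Lc.comp (e : (Fin 2 → ℝ) →L[ℝ] ℂ)) p :=
      h1.comp p e.hasFDerivAt
    exact e.symm.hasFDerivAt.comp p h2
  · have hconj : (((e.symm : ℂ →L[ℝ] (Fin 2 → ℝ)).comp (Lc.comp (e : (Fin 2 → ℝ) →L[ℝ] ℂ)) :
        (Fin 2 → ℝ) →L[ℝ] (Fin 2 → ℝ)) : (Fin 2 → ℝ) →ₗ[ℝ] (Fin 2 → ℝ)) =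
        (e.symm.toLinearEquiv : ℂ →ₗ[ℝ] (Fin 2 → ℝ)) ∘ₗ (Lc : ℂ →ₗ[ℝ] ℂ) ∘ₗ
          (e.symm.toLinearEquiv.symm : (Fin 2 → ℝ) →ₗ[ℝ] ℂ) := by
      apply LinearMap.ext
      intro v
      rfl
    rw [ContinuousLinearMap.det, hconj, LinearMap.det_conj]
    exact Literature.Analysis.Complex.LengthArea.det_restrictScalars_smulRight c

end Equiv

section Sheets

variable (e : (Fin 2 → ℝ) ≃L[ℝ] ℂ) (he : ∀ p, e p = p 0 + p 1 * I) (he' : ∀ w, e.symm w = ![w.re, w.im])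

include he he' in
/-- The x-map, read as a map of the real plane, is `ℚ`-semialgebraic on every `ℚ`-semialgebraic
`σ ⊆ {x ≠ 0}`: its coordinates `x + a + b x/(x² + y²)`, `y − b y/(x² + y²)` are quotients of
rational polynomials with non-vanishing denominator. [cite: BochnakCosteRoy1998, §2.2] -/
theorem isSemialgebraicMapOn_Phi (a b : ℚ) {σ : Set (Fin 2 → ℝ)} (hσ : IsSemialgebraic ℚ σ)
    (h0 : σ ⊆ {p | p 0 ≠ 0}) :
    IsSemialgebraicMapOn ℚ σ (fun q => e.symm (e q + (a : ℝ) + (b : ℝ) / e q)) := by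
  have hq : ∀ p ∈ σ, aeval p (X 0 ^ 2 + X 1 ^ 2 : MvPolynomial (Fin 2) ℚ) ≠ 0 := by
    intro p hp
    have h : p 0 ≠ 0 := h0 hp
    have : 0 < p 0 ^ 2 + p 1 ^ 2 := by positivity
    simpa using this.ne'
  have hρ : ∀ p ∈ σ, Complex.normSq (e p) ≠ 0 := fun p hp =>
    (Complex.normSq_pos.mpr (equiv_ne_zero e he (h0 hp))).ne'
  refine IsSemialgebraicMapOn.of_forall hσ fun j => ?_
  fin_cases j
  · refine (isSemialgebraicFunOn_aeval_div_aeval hσ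
      ((X 0 + C a) * (X 0 ^ 2 + X 1 ^ 2) + C b * X 0) (X 0 ^ 2 + X 1 ^ 2) hq).congr fun p hp => ?_
    obtain ⟨h1, -, h3⟩ := equiv_re_im e he p
    have hre := (xmap_re_im (a : ℝ) (b : ℝ) (e p)).1
    simp only [Fin.zero_eta, Fin.isValue, (equiv_symm_apply e he' _).1, hre, h1, h3]
    have := hq p hp
    simp only [map_add, map_pow, aeval_X, ne_eq] at this
    simp only [map_add, map_mul, map_pow, aeval_X, aeval_C, eq_ratCast]
    field_simp
  · refine (isSemialgebraicFunOn_aeval_div_aeval hσ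
      (X 1 * (X 0 ^ 2 + X 1 ^ 2) - C b * X 1) (X 0 ^ 2 + X 1 ^ 2) hq).congr fun p hp => ?_
    obtain ⟨-, h2, h3⟩ := equiv_re_im e he p
    have him := (xmap_re_im (a : ℝ) (b : ℝ) (e p)).2
    simp only [Fin.mk_one, Fin.isValue, (equiv_symm_apply e he' _).2, him, h2, h3]
    have := hq p hp
    simp only [map_add, map_pow, aeval_X, ne_eq] at this
    simp only [map_sub, map_add, map_mul, map_pow, aeval_X, aeval_C, eq_ratCast]
    field_simp

include he he' in
/-- **The sheets map into `T = {Re ≠ a, Im ≠ 0}`**: for `x ≠ 0`, `y ≠ 0`, `(x² + y²)² ≠ b²` the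
image point `Φ p` has first coordinate `≠ a` and second coordinate `≠ 0`. [folklore] -/
theorem Phi_mem_T (a b : ℝ) {p : Fin 2 → ℝ} (h0 : p 0 ≠ 0) (h1 : p 1 ≠ 0)
    (h2 : (p 0 ^ 2 + p 1 ^ 2) ^ 2 ≠ b ^ 2) :
    e.symm (e p + a + b / e p) 0 ≠ a ∧ e.symm (e p + a + b / e p) 1 ≠ 0 := by
  obtain ⟨hr, hi, hn⟩ := equiv_re_im e he p
  have hw : e p ≠ 0 := equiv_ne_zero e he h0
  have hg := (xmap_good_iff a b hw).mpr ⟨hr ▸ h0, hi ▸ h1, hn ▸ h2⟩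
  rw [(equiv_symm_apply e he' _).1, (equiv_symm_apply e he' _).2]
  exact ⟨hg.2, hg.1⟩

include he he' in
/-- **Each sheet covers `T`**: a point `q` with `q 0 ≠ a`, `q 1 ≠ 0` has a `Φ`-preimage with
`x, y ≠ 0` and `(x² + y²)² > b²` and one with `x, y ≠ 0` and `(x² + y²)² < b²` (the two roots
`z`, `b/z` of `z² − (W − a) z + b`, `W = q 0 + q 1 I`; `|z|²·|b/z|² = b²`). [folklore] -/
theorem exists_Phi_eq (a b : ℝ) (hb : b ≠ 0) {q : Fin 2 → ℝ} (hq0 : q 0 ≠ a) (hq1 : q 1 ≠ 0) :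
    (∃ p : Fin 2 → ℝ, (p 0 ≠ 0 ∧ p 1 ≠ 0 ∧ b ^ 2 < (p 0 ^ 2 + p 1 ^ 2) ^ 2) ∧
        e.symm (e p + a + b / e p) = q) ∧
      (∃ p : Fin 2 → ℝ, (p 0 ≠ 0 ∧ p 1 ≠ 0 ∧ (p 0 ^ 2 + p 1 ^ 2) ^ 2 < b ^ 2) ∧
        e.symm (e p + a + b / e p) = q) := by
  have hbC : (b : ℂ) ≠ 0 := Complex.ofReal_ne_zero.mpr hb
  obtain ⟨z, hz, hzq⟩ := exists_xmap_eq (a : ℂ) hbC (e q)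
  have hz' : (b : ℂ) / z ≠ 0 := div_ne_zero hbC hz
  have hzq' : (b : ℂ) / z + a + b / (b / z) = e q := by rw [xmap_div_eq (a : ℂ) z hbC, hzq]
  obtain ⟨hqr, hqi, -⟩ := equiv_re_im e he q
  -- both preimages are "good"
  have good : ∀ u : ℂ, u ≠ 0 → u + a + b / u = e q →
      u.re ≠ 0 ∧ u.im ≠ 0 ∧ Complex.normSq u ^ 2 ≠ b ^ 2 := by
    intro u hu huq
    refine (xmap_good_iff a b hu).mp ?_
    rw [huq, hqr, hqi]
    exact ⟨hq1, hq0⟩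
  -- the candidate points of the plane
  have cand : ∀ u : ℂ, u ≠ 0 → u + a + b / u = e q →
      (e.symm u 0 ≠ 0 ∧ e.symm u 1 ≠ 0 ∧
        (e.symm u 0 ^ 2 + e.symm u 1 ^ 2) ^ 2 = Complex.normSq u ^ 2) ∧
      e.symm (e (e.symm u) + a + b / e (e.symm u)) = q := by
    intro u hu huq
    obtain ⟨g0, g1, -⟩ := good u hu huq
    rw [(equiv_symm_apply e he' u).1, (equiv_symm_apply e he' u).2, e.apply_symm_apply, huq,
      e.symm_apply_apply, Complex.normSq_apply]
    exact ⟨⟨g0, g1, by ring⟩, rfl⟩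
  have hρ : 0 < Complex.normSq z := Complex.normSq_pos.mpr hz
  have hρ' : Complex.normSq ((b : ℂ) / z) = b ^ 2 / Complex.normSq z := normSq_div_self b z
  have hb2 : 0 < b ^ 2 := by positivity
  obtain ⟨⟨c0, c1, c2⟩, cq⟩ := cand z hz hzq
  obtain ⟨⟨d0, d1, d2⟩, dq⟩ := cand _ hz' hzq'
  rcases lt_or_gt_of_ne (good z hz hzq).2.2 with hlt | hgt
  · -- |z|⁴ < b²: `z` on the inner sheet, `b/z` on the outer one
    refine ⟨⟨e.symm (b / z), ⟨d0, d1, ?_⟩, dq⟩, ⟨e.symm z, ⟨c0, c1, by rwa [c2]⟩, cq⟩⟩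
    rw [d2, hρ', div_pow, lt_div_iff₀ (by positivity)]
    nlinarith
  · refine ⟨⟨e.symm z, ⟨c0, c1, by rwa [c2]⟩, cq⟩, ⟨e.symm (b / z), ⟨d0, d1, ?_⟩, dq⟩⟩
    rw [d2, hρ', div_pow, div_lt_iff₀ (by positivity)]
    nlinarith

include he in
/-- **Injectivity on each sheet**: `Φ p = Φ p'` forces `e p = e p'` or `e p · e p' = b`, and the
latter is impossible when `|e p|⁴, |e p'|⁴` are both `> b²` or both `< b²`. [folklore] -/
theorem injOn_Phi (a b : ℝ) (hb : b ≠ 0) :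
    InjOn (fun q => e.symm (e q + a + b / e q))
        {p | p 0 ≠ 0 ∧ p 1 ≠ 0 ∧ b ^ 2 < (p 0 ^ 2 + p 1 ^ 2) ^ 2} ∧
      InjOn (fun q => e.symm (e q + a + b / e q))
        {p | p 0 ≠ 0 ∧ p 1 ≠ 0 ∧ (p 0 ^ 2 + p 1 ^ 2) ^ 2 < b ^ 2} := by
  have key : ∀ p p' : Fin 2 → ℝ, p 0 ≠ 0 → p' 0 ≠ 0 →
      e.symm (e p + a + b / e p) = e.symm (e p' + a + b / e p') →
      p = p' ∨ (p 0 ^ 2 + p 1 ^ 2) * (p' 0 ^ 2 + p' 1 ^ 2) = b ^ 2 := by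
    intro p p' hp hp' h
    have hw := equiv_ne_zero e he hp
    have hw' := equiv_ne_zero e he hp'
    rcases (xmap_eq_xmap_iff (a : ℂ) (b : ℂ) hw hw').mp (e.symm.injective h) with h | h
    · exact Or.inl (e.injective h)
    · right
      rw [← (equiv_re_im e he p).2.2, ← (equiv_re_im e he p').2.2, ← Complex.normSq_mul, h,
        Complex.normSq_ofReal, sq]
  have hb2 : 0 < b ^ 2 := by positivity
  constructor
  · rintro p ⟨hp0, -, hp⟩ p' ⟨hp0', -, hp'⟩ h
    rcases key p p' hp0 hp0' h with h | h
    · exact h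
    · exfalso
      have h3 := mul_lt_mul'' hp hp' hb2.le hb2.le
      have h4 : (p 0 ^ 2 + p 1 ^ 2) ^ 2 * (p' 0 ^ 2 + p' 1 ^ 2) ^ 2 = b ^ 2 * b ^ 2 := by
        rw [← h]; ring
      rw [h4] at h3
      exact lt_irrefl _ h3
  · rintro p ⟨hp0, -, hp⟩ p' ⟨hp0', -, hp'⟩ h
    rcases key p p' hp0 hp0' h with h | h
    · exact h
    · exfalso
      have h3 := mul_lt_mul'' hp hp' (sq_nonneg _) (sq_nonneg _)
      have h4 : (p 0 ^ 2 + p 1 ^ 2) ^ 2 * (p' 0 ^ 2 + p' 1 ^ 2) ^ 2 = b ^ 2 * b ^ 2 := by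
        rw [← h]; ring
      rw [h4] at h3
      exact lt_irrefl _ h3

include he he' in
/-- **`Φ` maps each sheet onto `T = {Re ≠ a, Im ≠ 0}`.** [folklore] -/
theorem image_Phi (a b : ℝ) (hb : b ≠ 0) :
    (fun q => e.symm (e q + a + b / e q)) ''
        {p | p 0 ≠ 0 ∧ p 1 ≠ 0 ∧ b ^ 2 < (p 0 ^ 2 + p 1 ^ 2) ^ 2} = {q | q 0 ≠ a ∧ q 1 ≠ 0} ∧
      (fun q => e.symm (e q + a + b / e q)) ''
        {p | p 0 ≠ 0 ∧ p 1 ≠ 0 ∧ (p 0 ^ 2 + p 1 ^ 2) ^ 2 < b ^ 2} = {q | q 0 ≠ a ∧ q 1 ≠ 0} := by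
  constructor
  · ext q
    constructor
    · rintro ⟨p, ⟨h0, h1, h2⟩, rfl⟩
      exact Phi_mem_T e he he' a b h0 h1 h2.ne'
    · rintro ⟨hq0, hq1⟩
      obtain ⟨⟨p, hp, hpq⟩, -⟩ := exists_Phi_eq e he he' a b hb hq0 hq1
      exact ⟨p, hp, hpq⟩
  · ext q
    constructor
    · rintro ⟨p, ⟨h0, h1, h2⟩, rfl⟩
      exact Phi_mem_T e he he' a b h0 h1 h2.ne
    · rintro ⟨hq0, hq1⟩
      obtain ⟨-, ⟨p, hp, hpq⟩⟩ := exists_Phi_eq e he he' a b hb hq0 hq1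
      exact ⟨p, hp, hpq⟩

end Sheets

end Summit.KontsevichZagierPeriods.MultivaluedCoV.TwoIsogenyAreaIdentity

end
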